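import Summits.CriticalPhenomena.SAWScalingLimit.Theses.SAWSpinMonotone
import HarnessLib.Audit

/-!
# Crux `SpinMonotone` (stmt-CriticalPhenomena-16769) — line `binomial-subordination`

Route `SAWSpinMonotone` (sub-problem `SAWScalingLimit`).  Crux, BY NAME:
`Summit.CriticalPhenomena.SAWScalingLimit.Theses.SAWSpinMonotone.SpinMonotone` = (FM): the modulus of
the PORT SUM `s ↦ ‖Σᵢ F_(Λ∖v)(a,{v,wᵢ}; x_c, s)‖` (spin-`s` transform of the first-arrival winding law at
`v`) is antitone on `[0, 3/2]` for every simply connected hexagonal domain.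

## The line: BINOMIAL SUBORDINATION of the symmetrised first-arrival winding law

Write the port sum as `e^{-isθ₀} Σ_{d<N} R_d e^{-is·2πd/3}` (`R ≥ 0` the winding-CLASS law, classes
`2π/3` apart; stub 1) and put `θ = 2πs/3 ∈ [0,π]`, `c = cos θ ∈ [-1,1]`.  Then
`‖PortSum(s)‖² = π_R(c) := Σ_{d,d'<N} R_d R_{d'} T_{|d-d'|}(c)` is a real polynomial in `c`
(Chebyshev `T`), and (FM) says `π_R` is non-decreasing on `[-1,1]`.

**The strategist's strengthening (class 𝓐, "binomial subordination").**  Expand `π_R` at the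
endpoint `c = -1` (spin `s = 3/2`): `π_R(c) = Σ_m p_m (1+c)^m`.  CLASS 𝓐: ALL `p_m ≥ 0`.  Equivalently
`‖PortSum(s)‖² = Σ_m p_m 2^m cos^{2m}(πs/3)`; equivalently the law of the relative winding class
`D - D'` of two INDEPENDENT first arrivals is a MIXTURE over `m` of the laws of `(ε₁+⋯+ε_{2m})/2`,
`εᵢ` i.i.d. fair signs (a simple random walk in half-classes — one hexagonal turn `±π/3` is half a
class — read at an INDEPENDENT random time); equivalently the alternating pair-moment inequalities
`A_m(R) := Σ_{d,d'<N} R_d R_{d'} (-1)^{d+d'+m} Π_{j<m}((d-d')² - j²) ≥ 0` for all `m ≥ 1`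
(`A_m = p_m · m! · (2m-1)!!` by `T_k^{(m)}(-1) = (-1)^{k+m} Π_{j<m}(k²-j²)/(2m-1)!!`; `A_0 = (Σ(-1)^d R_d)²`
is automatic).  𝓐 ⟹ (FM) trivially (each `cos^{2m}(πs/3)` is antitone on `[0,3/2]`); 𝓐 is closed under
convolution of laws (products of transforms) and contains every Pólya-frequency law, in particular
every discrete Gaussian `q^{(d-μ)²}` (Jacobi triple product ⟹ `|ϑ̂|²` is a product of positive
increasing LINEAR functions of `c`), and it is STRICTLY between PF_∞ and (FM) (`(e,1,1,e)` with
`e = 1/2` is (FM) but not 𝓐).  It is the discrete-circle analogue of the mechanism that makes the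
Brownian / random-walk version of (FM) true: there the winding is an independent Brownian motion read
at an independent random time (log-conformal coordinates), so its characteristic function is a Gaussian
SCALE MIXTURE, completely monotone in `θ²`; here `|ch.f.|²` is ABSOLUTELY MONOTONE in `1 + cos θ`.

EVIDENCE (this seat, exact arithmetic in `ℚ(√2)`, folder `exp/`): 𝓐 holds for EVERY first-arrival law
of: all 1,059 fixed polyhexes ≤ 6 cells × all sources × all vertices (354,642 laws, up to 8 classes);
the radius-1 and radius-2 balls, all sources × all vertices (1,230 laws, up to 14 classes); 820 random
non-face-union simply connected vertex sets of 6–40 vertices (139,977 laws, up to 9 classes) —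
0 failures; with a one-vertex HOLE 𝓐 fails 44/264 and (FM) 30/264 (hypothesis load-bearing); the
enumerator reproduces the route seat's 60,540 laws / max mode ratio 0.9097 exactly.  Deeper checks
(7-cell polyhexes, radius-3 ball, strips) run as kit job j024426.  Dead would-be strengthenings
recorded for the lead: real-rootedness of `Σ R_d z^d` (fails at 2 cells), per-root sector condition
`cos ψ ≥ 2r/(1+r²)` (fails at 5 cells, 5-ring around a missing cell), log-concavity of `R`
(2,922/60,540 failures), `R_{d-1}R_{d+1} ≤ R_d²/4` (fails at 2 cells).

## Stubs (4 registered) + one PROVED dictionary lemma + the composition (no sorry outside stubs)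

* `stub_windingClassExpansion` — STRUCTURE (provable now; identical statement to `Lines/birth.lean`'s):
  the port sum is `e^{-isθ₀} Σ_{d<N} R_d e^{-is·2πd/3}` with `R ≥ 0`.
* `stub_endpointConvexity` — FIRST LEMMA of the line (open; the binding inequality in all data):
  `A_1(R) ≥ 0`, i.e. `Σ_{d,d'} R_d R_{d'} (-1)^{d+d'+1}(d-d')² ≥ 0`: `θ = π` (spin `3/2`, weight `∓i`
  per turn) is a local MINIMUM of `‖PortSum‖²` — a REVERSE Cauchy–Schwarz `B² ≥ AΓ` for the
  parity-signed law `(-1)^d R_d` (`A = Σ(-1)^dR_d`, `B = Σ(-1)^d dR_d`, `Γ = Σ(-1)^d d²R_d`); for laws on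
  ≤ 3 classes it is ALL of (FM) (`R₁(R₀+R₂) ≥ 4R₀R₂`).
* `stub_higherAlternatingMoments` — THE HEART (open): `A_m(R) ≥ 0` for every `m ≥ 2`.
* `stub_binomialExpansion` — ALGEBRA (provable now, Chebyshev–Taylor at `-1`): for ANY real `R`,
  `(∀ m ≥ 1, A_m(R) ≥ 0) → ∃ p ≥ 0, ∀ s, ‖Σ_{d<N} R_d e^{-is2πd/3}‖² = Σ_{m<N} p_m (1 + cos(2πs/3))^m`.
* `subordinationCriterion` — ANALYSIS, PROVED here: such an identity with `p ≥ 0` makes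
  `s ↦ ‖G s‖` antitone on `[0,3/2]`.
* `SpinMonotone_of` — the crux BY NAME from the four stubs (kernel-checked, no sorry).

Disproof used: none exists for this crux (`ledger crux ls`: only `Lines/birth.*`; no `Disproof.lean`,
no Negative lemmas); negatives index: no statement on winding laws.  Simple connectivity is consumed by
stubs 2–3 only (holes ⇒ gap laws violate `A_1`).  Why this dodges the STUCK shape of `birth`: birth's
heart is (FM) differentiated (`Σ k C_k sin kθ ≥ 0` on a continuum of `θ`, no structure in the
crossover); here the heart is a graded family of SIGNED PAIR COUNTS with integer polynomial weights in
the relative winding — the objects on which DCS-style pair/triple involutions, winding-raising detours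
(`k ↦ k±1` around one hexagon at `v`, weighted by `Π(k²-j²)`), and product/convolution (multi-scale)
arguments act, and whose Markov/Brownian sibling is a theorem (subordination).
Sources: arXiv:1007.0575 (DCS 2012, Lemma 1 pair/triple grouping); Karlin 1968 (total positivity, PF
sequences); Askey–Steinig 1974; Spitzer 1958 / arXiv:math/9904022 §7 (Brownian & SLE windings);
Widder 1941 (absolutely monotone functions); card `Ideas/_closed/spin-monotone-winding-laws.md`.
-/

noncomputable section

open scoped BigOperators
open Literature.Probability.RandomPlanarGeometry Literature.Probability.RandomPlanarGeometry.SAW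
open Literature.Probability.LatticeModels

namespace Summit.CriticalPhenomena.SAWScalingLimit.Cruxes.SpinMonotone.BinomialSubordination

/-! ## The registered stubs -/

/-- **stub 1 — WINDING-CLASS EXPANSION of the port sum (structure; provable now; same statement as
`Lines/birth.lean`'s `stub_windingClassExpansion`).**  For a boundary mid-edge `a` of `Λ`, `v ∈ Λ` and
neighbours `w₀ w₁ w₂` of `v` there are a phase `θ₀`, a bound `N` and a NON-NEGATIVE `R : ℕ → ℝ` (the
first-arrival winding law indexed by winding class from the minimal winding) with
`PortSum(s) = e^{-isθ₀} Σ_{d<N} R_d e^{-is·2πd/3}` for every real `s`.  Content: turns are `±π/3`,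
`hexGraph` is bipartite, the three directions into `v` differ by `2π/3`, so all windings to the three
ports lie in one coset of `(2π/3)ℤ`; regroup the finite sum.  Why it might fail: only by a mismatch
with the library encoding of `winding` (first/last half-segments are parallel to `a`, `{v,wᵢ}`, so no
turn is lost).  Size M/L.  Sources: arXiv:1007.0575 §2; `HexMidEdgeSAW.winding/weight`. -/
theorem stub_windingClassExpansion : ∀ (Λ : Finset Literature.Probability.LatticeModels.HexVertex), ∀ a ∈ Literature.Probability.RandomPlanarGeometry.SAW.hexDomainBoundary Λ, ∀ v ∈ Λ, ∀ w₀ w₁ w₂ : Literature.Probability.LatticeModels.HexVertex, Literature.Probability.LatticeModels.hexGraph.Adj v w₀ → Literature.Probability.LatticeModels.hexGraph.Adj v w₁ → Literature.Probability.LatticeModels.hexGraph.Adj v w₂ → ∃ (θ₀ : ℝ) (N : ℕ) (R : ℕ → ℝ), (∀ d, 0 ≤ R d) ∧ ∀ s : ℝ, Literature.Probability.RandomPlanarGeometry.SAW.hexParafermionicObservable (Λ.erase v) a Literature.Probability.RandomPlanarGeometry.SAW.hexCriticalFugacity s s(v, w₀) + Literature.Probability.RandomPlanarGeometry.SAW.hexParafermionicObservable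 (Λ.erase v) a Literature.Probability.RandomPlanarGeometry.SAW.hexCriticalFugacity s s(v, w₁) + Literature.Probability.RandomPlanarGeometry.SAW.hexParafermionicObservable (Λ.erase v) a Literature.Probability.RandomPlanarGeometry.SAW.hexCriticalFugacity s s(v, w₂) = Complex.exp (-Complex.I * s * θ₀) * ∑ d ∈ Finset.range N, (R d : ℂ) * Complex.exp (-Complex.I * s * (2 * Real.pi * d / 3)) := by
  sorry

/-- **stub 2 — ENDPOINT CONVEXITY `A_1 ≥ 0` (the FIRST LEMMA of the line; open).**  For a SIMPLY
CONNECTED `Λ`, boundary mid-edge `a`, `v ∈ Λ` with pairwise distinct neighbours, and ANY winding-class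
representation `(θ₀, N, R ≥ 0)` of the port sum (necessarily the first-arrival law up to an index
shift; the double sum below is shift-invariant):
`Σ_{d,d'<N} R_d R_{d'} (-1)^{d+d'+1} (d-d')² ≥ 0`.
Meaning: `‖PortSum(s)‖²` has a local MINIMUM at `s = 3/2` (`θ = π`, weight `∓i` per hexagonal turn),
i.e. the reverse Cauchy–Schwarz `B² ≥ AΓ` for the parity-signed law `(-1)^d R_d`; equivalently the
odd-lag autocorrelation dominates the even-lag one with weights `k²`:
`Σ_{k odd} k² C_k ≥ Σ_{k even} k² C_k`, `C_k = Σ_d R_d R_{d+k}` (pairs of independent first arrivals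
at relative winding class `k`).  For laws on ≤ 3 classes this IS (FM) (`R₁(R₀+R₂) ≥ 4R₀R₂`); in all
enumerated data it is the binding constraint of (FM) (minimal margin at `θ = π`).  Why it might fail:
deep in the bulk `A`, `B`, `Γ` are alternating sums over a wide bell-shaped law — exponentially small
in the winding variance for an exact discrete Gaussian, but for the SAW law governed by its
lattice-scale fine structure; a law whose heavier parity class is also the more concentrated one
(`q(x,y) = Σ(-1)^d R_d (x+yd)²` definite) breaks it — gap laws `(p,0,q)` do, and they occur exactly at
holes.  Size L–XL.  Sources: arXiv:1007.0575; Karlin 1968 ch. 8; this seat's `exp/` (494k laws, 0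
failures; holed control fails). -/
theorem stub_endpointConvexity : ∀ (Λ : Finset Literature.Probability.LatticeModels.HexVertex), Literature.Probability.RandomPlanarGeometry.SAW.hexDomainSimplyConnected Λ → ∀ a ∈ Literature.Probability.RandomPlanarGeometry.SAW.hexDomainBoundary Λ, ∀ v ∈ Λ, ∀ w₀ w₁ w₂ : Literature.Probability.LatticeModels.HexVertex, Literature.Probability.LatticeModels.hexGraph.Adj v w₀ → Literature.Probability.LatticeModels.hexGraph.Adj v w₁ → Literature.Probability.LatticeModels.hexGraph.Adj v w₂ → w₀ ≠ w₁ → w₁ ≠ w₂ → w₀ ≠ w₂ → ∀ (θ₀ : ℝ) (N : ℕ) (R : ℕ → ℝ), (∀ d, 0 ≤ R d) → (∀ s : ℝ, Literature.Probability.RandomPlanarGeometry.SAW.hexParafermionicObservable (Λ.erase v) a Literature.Probability.RandomPlanarGeometry.SAW.hexCriticalFugacity s s(v, w₀) + Literature.Probability.RandomPlanarGeometry.SAW.hexParafermionicObservable (Λ.erase v) a Literature.Probability.RandomPlanarGeometry.SAW.hexCriticalFugacity s s(v, w₁) + Literature.Probability.RandomPlanarGeometry.SAW.hexParafermionicObservable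 (Λ.erase v) a Literature.Probability.RandomPlanarGeometry.SAW.hexCriticalFugacity s s(v, w₂) = Complex.exp (-Complex.I * s * θ₀) * ∑ d ∈ Finset.range N, (R d : ℂ) * Complex.exp (-Complex.I * s * (2 * Real.pi * d / 3))) → 0 ≤ ∑ d ∈ Finset.range N, ∑ d' ∈ Finset.range N, R d * R d' * (-1 : ℝ) ^ (d + d' + 1) * ((d : ℝ) - d') ^ 2 := by
  sorry

/-- **stub 3 — HIGHER ALTERNATING PAIR MOMENTS `A_m ≥ 0`, `m ≥ 2` (THE HEART; open).**  Same setting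
as stub 2; for every `m ≥ 2`:
`A_m(R) := Σ_{d,d'<N} R_d R_{d'} (-1)^{d+d'+m} Π_{j<m} ((d-d')² - j²) ≥ 0`.
Together with stub 2 (`m = 1`; `m = 0` is a square) this is CLASS 𝓐: all Taylor coefficients of
`c ↦ ‖PortSum‖²` at `c = cos θ = -1` are `≥ 0` (`A_m = p_m·m!·(2m-1)!!`), i.e. the symmetrised
first-arrival winding law is a binomial time-mixture (`|ch.f.|² = Σ p_m 2^m cos^{2m}(θ/2)`).  Only lags
`k ≥ m` enter `A_m` (the product vanishes for `|d-d'| < m`), with leading term `+C_m·(2m-1)!·2/…`: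
`A_m` is "lag `m` dominates the alternating tail beyond it", a graded family of SIGNED PAIR COUNTS.
Transfer / why easier: these are the objects on which pair involutions and winding-raising detours act
(`k ↦ k ± 1` by rerouting one arrival around one hexagon at `v`, profitable because the weight grows
like `k^{2m}`), on which the multiplicative structure is exact (𝓐 is closed under convolution of laws,
so a renewal/product decomposition of the arrival preserves it factor by factor), and whose Markovian
sibling is a theorem (independent angular walk at an independent time).  Why it might fail: for wide
laws (winding variance `σ² ≳ 1` class², depth ≳ 10²) the coefficients `p_m`, `m ≲ 2σ² log m`, are
exponentially small alternating sums; exact for discrete Gaussians (PF), they survive boundary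
corrections only if these act multiplicatively (convolution `R ≈ J∗ϑ_σ∗K`) rather than additively —
the first place to look for a counterexample is a deep bisecting-axis source (h-type law) at `m = 2`.
Size XL.  Sources: as stub 2; Widder 1941 (absolute monotonicity); arXiv:math/9904022 §7. -/
theorem stub_higherAlternatingMoments : ∀ (Λ : Finset Literature.Probability.LatticeModels.HexVertex), Literature.Probability.RandomPlanarGeometry.SAW.hexDomainSimplyConnected Λ → ∀ a ∈ Literature.Probability.RandomPlanarGeometry.SAW.hexDomainBoundary Λ, ∀ v ∈ Λ, ∀ w₀ w₁ w₂ : Literature.Probability.LatticeModels.HexVertex, Literature.Probability.LatticeModels.hexGraph.Adj v w₀ → Literature.Probability.LatticeModels.hexGraph.Adj v w₁ → Literature.Probability.LatticeModels.hexGraph.Adj v w₂ → w₀ ≠ w₁ → w₁ ≠ w₂ → w₀ ≠ w₂ → ∀ (θ₀ : ℝ) (N : ℕ) (R : ℕ → ℝ), (∀ d, 0 ≤ R d) → (∀ s : ℝ, Literature.Probability.RandomPlanarGeometry.SAW.hexParafermionicObservable (Λ.erase v) a Literature.Probability.RandomPlanarGeometry.SAW.hexCriticalFugacity s s(v, w₀)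 + Literature.Probability.RandomPlanarGeometry.SAW.hexParafermionicObservable (Λ.erase v) a Literature.Probability.RandomPlanarGeometry.SAW.hexCriticalFugacity s s(v, w₁) + Literature.Probability.RandomPlanarGeometry.SAW.hexParafermionicObservable (Λ.erase v) a Literature.Probability.RandomPlanarGeometry.SAW.hexCriticalFugacity s s(v, w₂) = Complex.exp (-Complex.I * s * θ₀) * ∑ d ∈ Finset.range N, (R d : ℂ) * Complex.exp (-Complex.I * s * (2 * Real.pi * d / 3))) → ∀ m : ℕ, 2 ≤ m → 0 ≤ ∑ d ∈ Finset.range N, ∑ d' ∈ Finset.range N, R d * R d' * (-1 : ℝ) ^ (d + d' + m) * ∏ j ∈ Finset.range m, (((d : ℝ) - d') ^ 2 - (j : ℝ) ^ 2) := by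
  sorry

/-- **stub 4 — BINOMIAL (Chebyshev–Taylor) EXPANSION (algebra; provable now).**  For ANY `N` and ANY
real `R`: if `A_m(R) ≥ 0` for all `m ≥ 1` (notation of stubs 2–3; `A_1` is stub 2's double sum since
`Π_{j<1}((d-d')²-j²) = (d-d')²`), then there are `p_m ≥ 0` with
`‖Σ_{d<N} R_d e^{-is·2πd/3}‖² = Σ_{m<N} p_m (1 + cos(2πs/3))^m` for every real `s`.
Proof route: `‖Σ R_d e^{-idθ}‖² = Σ_{d,d'} R_d R_{d'} cos((d-d')θ) = Σ_{d,d'} R_dR_{d'} T_{|d-d'|}(cos θ)`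
(`Polynomial.Chebyshev.T_real_cos`), a polynomial of degree `< N` in `c = cos θ`; its Taylor expansion
at `c = -1` (`Polynomial.taylor`, `Polynomial.sum_taylor_eq`) has coefficients
`p_m = A_m/(m!·(2m-1)!!)` by `T_k^{(m)}(-1) = (-1)^{k+m} Π_{j<m}(k²-j²)/(2m-1)!!` (from
`(1-x²)T'' - xT' + k²T = 0` differentiated `m` times at `x = -1`), and `p_0 = (Σ_d(-1)^dR_d)² ≥ 0`.
The closed form is verified exactly on 1,167 random/corpus instances (`exp/check_closedform.py`).
Why it might fail: it does not (finite-dimensional linear algebra; care only with the `ℕ`-indexed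
bookkeeping).  Size M.  Sources: Rivlin, *Chebyshev polynomials* (1974) §1.5; Mathlib
`Polynomial.Chebyshev`, `Polynomial.taylor`. -/
theorem stub_binomialExpansion : ∀ (N : ℕ) (R : ℕ → ℝ), (∀ m : ℕ, 1 ≤ m → 0 ≤ ∑ d ∈ Finset.range N, ∑ d' ∈ Finset.range N, R d * R d' * (-1 : ℝ) ^ (d + d' + m) * ∏ j ∈ Finset.range m, (((d : ℝ) - d') ^ 2 - (j : ℝ) ^ 2)) → ∃ p : ℕ → ℝ, (∀ m, 0 ≤ p m) ∧ ∀ s : ℝ, ‖∑ d ∈ Finset.range N, (R d : ℂ) * Complex.exp (-Complex.I * s * (2 * Real.pi * d / 3))‖ ^ 2 = ∑ m ∈ Finset.range N, p m * (1 + Real.cos (2 * Real.pi * s / 3)) ^ m := by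
  sorry

/-! ## The dictionary lemma, proved: a binomial time-mixture has antitone modulus -/

/-- **Subordination criterion (proved).**  If `‖G s‖² = Σ_{m<N} p_m (1 + cos(2πs/3))^m` with all
`p_m ≥ 0`, then `s ↦ ‖G s‖` is antitone on `[0, 3/2]`: `2πs/3 ∈ [0,π]` where `cos` is antitone,
`1 + cos ≥ 0`, powers and non-negative combinations preserve the order, and `‖·‖ ≥ 0` lets us drop the
square. [cite: Widder 1941, ch. IV (absolutely monotone functions); folklore] -/
theorem subordinationCriterion : ∀ (N : ℕ) (G : ℝ → ℂ) (p : ℕ → ℝ), (∀ m, 0 ≤ p m) →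
    (∀ s : ℝ, ‖G s‖ ^ 2 = ∑ m ∈ Finset.range N, p m * (1 + Real.cos (2 * Real.pi * s / 3)) ^ m) →
    AntitoneOn (fun s : ℝ => ‖G s‖) (Set.Icc (0 : ℝ) (3 / 2)) := by
  intro N G p hp hG s hs t ht hst
  have hpi := Real.pi_pos
  have hcos : Real.cos (2 * Real.pi * t / 3) ≤ Real.cos (2 * Real.pi * s / 3) := by
    apply Real.cos_le_cos_of_nonneg_of_le_pi
    · have := hs.1
      positivity
    · have := ht.2
      nlinarith
    · nlinarith
  have h1 : 0 ≤ 1 + Real.cos (2 * Real.pi * t / 3) := by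
    linarith [Real.neg_one_le_cos (2 * Real.pi * t / 3)]
  have hsq : ‖G t‖ ^ 2 ≤ ‖G s‖ ^ 2 := by
    rw [hG t, hG s]
    refine Finset.sum_le_sum fun m _ => ?_
    exact mul_le_mul_of_nonneg_left (pow_le_pow_left₀ h1 (by linarith) m) (hp m)
  -- drop the squares
  have hs0 : 0 ≤ ‖G s‖ := norm_nonneg _
  have ht0 : 0 ≤ ‖G t‖ := norm_nonneg _
  nlinarith [hsq, hs0, ht0, sq_nonneg (‖G t‖ - ‖G s‖), sq_nonneg (‖G t‖ + ‖G s‖)]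

/-! ## Name-keyed aliases of the stub statements (skeleton-check convention) -/

namespace Registered

/-- Alias keyed by the stub name: the statement of `stub_windingClassExpansion`. -/
abbrev stub_windingClassExpansion : Prop :=
  ∀ (Λ : Finset Literature.Probability.LatticeModels.HexVertex), ∀ a ∈ Literature.Probability.RandomPlanarGeometry.SAW.hexDomainBoundary Λ, ∀ v ∈ Λ, ∀ w₀ w₁ w₂ : Literature.Probability.LatticeModels.HexVertex, Literature.Probability.LatticeModels.hexGraph.Adj v w₀ → Literature.Probability.LatticeModels.hexGraph.Adj v w₁ → Literature.Probability.LatticeModels.hexGraph.Adj v w₂ → ∃ (θ₀ : ℝ) (N : ℕ) (R : ℕ → ℝ), (∀ d, 0 ≤ R d) ∧ ∀ s : ℝ, Literature.Probability.RandomPlanarGeometry.SAW.hexParafermionicObservable (Λ.erase v) a Literature.Probability.RandomPlanarGeometry.SAW.hexCriticalFugacity s s(v, w₀) + Literature.Probability.RandomPlanarGeometry.SAW.hexParafermionicObservable (Λ.erase v) a Literature.Probability.RandomPlanarGeometry.SAW.hexCriticalFugacity s s(v, w₁) + Literature.Probability.RandomPlanarGeometry.SAW.hexParafermionicObservable (Λ.erase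 v) a Literature.Probability.RandomPlanarGeometry.SAW.hexCriticalFugacity s s(v, w₂) = Complex.exp (-Complex.I * s * θ₀) * ∑ d ∈ Finset.range N, (R d : ℂ) * Complex.exp (-Complex.I * s * (2 * Real.pi * d / 3))

/-- Alias keyed by the stub name: the statement of `stub_endpointConvexity`. -/
abbrev stub_endpointConvexity : Prop :=
  ∀ (Λ : Finset Literature.Probability.LatticeModels.HexVertex), Literature.Probability.RandomPlanarGeometry.SAW.hexDomainSimplyConnected Λ → ∀ a ∈ Literature.Probability.RandomPlanarGeometry.SAW.hexDomainBoundary Λ, ∀ v ∈ Λ, ∀ w₀ w₁ w₂ : Literature.Probability.LatticeModels.HexVertex, Literature.Probability.LatticeModels.hexGraph.Adj v w₀ → Literature.Probability.LatticeModels.hexGraph.Adj v w₁ → Literature.Probability.LatticeModels.hexGraph.Adj v w₂ → w₀ ≠ w₁ → w₁ ≠ w₂ → w₀ ≠ w₂ → ∀ (θ₀ : ℝ) (N : ℕ) (R : ℕ → ℝ), (∀ d, 0 ≤ R d) → (∀ s : ℝ, Literature.Probability.RandomPlanarGeometry.SAW.hexParafermionicObservable (Λ.erase v) a Literature.Probability.RandomPlanarGeometry.SAW.hexCriticalFugacity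 s s(v, w₀) + Literature.Probability.RandomPlanarGeometry.SAW.hexParafermionicObservable (Λ.erase v) a Literature.Probability.RandomPlanarGeometry.SAW.hexCriticalFugacity s s(v, w₁) + Literature.Probability.RandomPlanarGeometry.SAW.hexParafermionicObservable (Λ.erase v) a Literature.Probability.RandomPlanarGeometry.SAW.hexCriticalFugacity s s(v, w₂) = Complex.exp (-Complex.I * s * θ₀) * ∑ d ∈ Finset.range N, (R d : ℂ) * Complex.exp (-Complex.I * s * (2 * Real.pi * d / 3))) → 0 ≤ ∑ d ∈ Finset.range N, ∑ d' ∈ Finset.range N, R d * R d' * (-1 : ℝ) ^ (d + d' + 1) * ((d : ℝ) - d') ^ 2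

/-- Alias keyed by the stub name: the statement of `stub_higherAlternatingMoments`. -/
abbrev stub_higherAlternatingMoments : Prop :=
  ∀ (Λ : Finset Literature.Probability.LatticeModels.HexVertex), Literature.Probability.RandomPlanarGeometry.SAW.hexDomainSimplyConnected Λ → ∀ a ∈ Literature.Probability.RandomPlanarGeometry.SAW.hexDomainBoundary Λ, ∀ v ∈ Λ, ∀ w₀ w₁ w₂ : Literature.Probability.LatticeModels.HexVertex, Literature.Probability.LatticeModels.hexGraph.Adj v w₀ → Literature.Probability.LatticeModels.hexGraph.Adj v w₁ → Literature.Probability.LatticeModels.hexGraph.Adj v w₂ → w₀ ≠ w₁ → w₁ ≠ w₂ → w₀ ≠ w₂ → ∀ (θ₀ : ℝ) (N : ℕ) (R : ℕ → ℝ), (∀ d, 0 ≤ R d) → (∀ s : ℝ, Literature.Probability.RandomPlanarGeometry.SAW.hexParafermionicObservable (Λ.erase v) a Literature.Probability.RandomPlanarGeometry.SAW.hexCriticalFugacity s s(v, w₀) + Literature.Probability.RandomPlanarGeometry.SAW.hexParafermionicObservable (Λ.erase v) a Literature.Probability.RandomPlanarGeometry.SAW.hexCriticalFugacity s s(v, w₁)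 + Literature.Probability.RandomPlanarGeometry.SAW.hexParafermionicObservable (Λ.erase v) a Literature.Probability.RandomPlanarGeometry.SAW.hexCriticalFugacity s s(v, w₂) = Complex.exp (-Complex.I * s * θ₀) * ∑ d ∈ Finset.range N, (R d : ℂ) * Complex.exp (-Complex.I * s * (2 * Real.pi * d / 3))) → ∀ m : ℕ, 2 ≤ m → 0 ≤ ∑ d ∈ Finset.range N, ∑ d' ∈ Finset.range N, R d * R d' * (-1 : ℝ) ^ (d + d' + m) * ∏ j ∈ Finset.range m, (((d : ℝ) - d') ^ 2 - (j : ℝ) ^ 2)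

/-- Alias keyed by the stub name: the statement of `stub_binomialExpansion`. -/
abbrev stub_binomialExpansion : Prop :=
  ∀ (N : ℕ) (R : ℕ → ℝ), (∀ m : ℕ, 1 ≤ m → 0 ≤ ∑ d ∈ Finset.range N, ∑ d' ∈ Finset.range N, R d * R d' * (-1 : ℝ) ^ (d + d' + m) * ∏ j ∈ Finset.range m, (((d : ℝ) - d') ^ 2 - (j : ℝ) ^ 2)) → ∃ p : ℕ → ℝ, (∀ m, 0 ≤ p m) ∧ ∀ s : ℝ, ‖∑ d ∈ Finset.range N, (R d : ℂ) * Complex.exp (-Complex.I * s * (2 * Real.pi * d / 3))‖ ^ 2 = ∑ m ∈ Finset.range N, p m * (1 + Real.cos (2 * Real.pi * s / 3)) ^ m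

end Registered

/-! ## The composition: the crux BY NAME from the four stubs -/

/-- **`SpinMonotone` from expansion + endpoint convexity + higher alternating moments + binomial
expansion** (and the proved criterion).  Fix the data of the crux; stub 1 gives `θ₀, N, R ≥ 0` with
`PortSum(s) = e^{-isθ₀}·G(s)`; stubs 2 and 3 give `A_m(R) ≥ 0` for `m = 1` and `m ≥ 2`; stub 4 turns
these into `‖G s‖² = Σ p_m (1+cos(2πs/3))^m`, `p ≥ 0`; `subordinationCriterion` gives antitonicity of
`‖G‖` on `[0,3/2]`, transported along the identity (`‖e^{-isθ₀}‖ = 1`).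
[cite: DuminilCopinSmirnov2012, Def. 1; Widder 1941] -/
theorem SpinMonotone_of (h₁ : Registered.stub_windingClassExpansion)
    (h₂ : Registered.stub_endpointConvexity) (h₃ : Registered.stub_higherAlternatingMoments)
    (h₄ : Registered.stub_binomialExpansion) :
    Summit.CriticalPhenomena.SAWScalingLimit.Theses.SAWSpinMonotone.SpinMonotone := by
  intro Λ hΛ a ha v hv w₀ w₁ w₂ hw₀ hw₁ hw₂ h₀₁ h₁₂ h₀₂
  -- the winding-class expansion of the port sum
  obtain ⟨θ₀, N, R, hR, hid⟩ := h₁ Λ a ha v hv w₀ w₁ w₂ hw₀ hw₁ hw₂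
  -- all alternating pair moments `A_m(R)`, `m ≥ 1`, are non-negative
  have hA : ∀ m : ℕ, 1 ≤ m → 0 ≤ ∑ d ∈ Finset.range N, ∑ d' ∈ Finset.range N,
      R d * R d' * (-1 : ℝ) ^ (d + d' + m) * ∏ j ∈ Finset.range m, (((d : ℝ) - d') ^ 2 - (j : ℝ) ^ 2) := by
    intro m hm
    rcases Nat.lt_or_ge m 2 with hlt | hge
    · have hm1 : m = 1 := by omega
      subst hm1
      have h := h₂ Λ hΛ a ha v hv w₀ w₁ w₂ hw₀ hw₁ hw₂ h₀₁ h₁₂ h₀₂ θ₀ N R hR hid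
      refine h.trans_eq ?_
      refine Finset.sum_congr rfl fun d _ => Finset.sum_congr rfl fun d' _ => ?_
      simp
    · exact h₃ Λ hΛ a ha v hv w₀ w₁ w₂ hw₀ hw₁ hw₂ h₀₁ h₁₂ h₀₂ θ₀ N R hR hid m hge
  -- binomial expansion of `‖G‖²` with non-negative coefficients
  obtain ⟨p, hp, hsq⟩ := h₄ N R hA
  -- the criterion gives antitonicity of `‖G‖`; transport it along the identity
  have hanti := subordinationCriterion N
    (fun s : ℝ => ∑ d ∈ Finset.range N, (R d : ℂ) * Complex.exp (-Complex.I * s * (2 * Real.pi * d / 3)))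
    p hp hsq
  have hunit : ∀ s : ℝ, ‖Complex.exp (-Complex.I * s * θ₀)‖ = 1 := by
    intro s
    rw [Complex.norm_exp]
    simp
  refine hanti.congr ?_
  intro s _
  simp only [hid s, norm_mul, hunit s, one_mul]

/-- Wiring / consistency check: the sorried stub THEOREMS are exactly the hypotheses of
`SpinMonotone_of` (the `Registered.stub_*` abbrevs unfold to their statements definitionally). -/
example : Summit.CriticalPhenomena.SAWScalingLimit.Theses.SAWSpinMonotone.SpinMonotone :=
  SpinMonotone_of stub_windingClassExpansion stub_endpointConvexity stub_higherAlternatingMoments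
    stub_binomialExpansion

end Summit.CriticalPhenomena.SAWScalingLimit.Cruxes.SpinMonotone.BinomialSubordination

end
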